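import Summits.QuantumFields.YangMills.Theorems.BalabanUVNodesN06Ineq3133SlotAAtPinsKnitQJ
import Literature.MathematicalPhysics.QuantumFieldTheory.Balaban1983to89.Node00.OpsYDeltaAFlat
import HarnessLib

/-!
# N06 [B9] — «P-H♭» (β)-FACE: (3.133) AT SLOT (a) FOR node00-def-Y's FLAT-PAIR LETTER `H♭[𝔮] = HAFlatY` (✓p827461 `Node00/OpsYDeltaAFlat`) — the by-name PARTNER STATEMENT
# of the owed readback `H1OfRecordAtBgFlat ↔ HAFlatY`, as the `T₀ := G♭[𝔮] = GAFlatY` instance of ✓`…N06Ineq3133SlotAAtPinsKnitQJ.ineq3133flat_of_pins_knit_J`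

Cell `pub-ymgap` (HUMAN RULING D-0062, Track A), node N06 = [Balaban1985BackgroundPropagators] («[B9]»); seat `pub-ymgap-dag-n06-l` (g42), 2026-08-31; node00-def-Y g39's (ρ♭) word
(«the slot-(a) OpsY row that discharges `h312` lives at KNIT bond pair × CENTRES site pair») and RR-2 g31's by-name pointer («the centres-pair instance is `T₀ := fun x => GAFlatY x.toKIdx a′
(𝔮 x) (𝔮s x)`»).  `--supports stmt-QuantumFields-27239 --as helper`; count-neutral.

WHAT.  ★★★ `ineq3133_HAFlatY_of_pins_knit_J` — ✓`ineq3133flat_of_pins_knit_J` at `T₀ := (U ↦ GAFlatY x.toKIdx a′ (𝔮 x) (𝔮s x) U)` with the read letter written BY NAME as def-Y's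
`HAFlatY (f j).toKIdx a′ (𝔮 (f j)) (𝔮s (f j))` (`= HOfQY … (GAFlatY …)`, definitionally the composite `G♭ ∘ 𝔮⋆ ∘ (𝔮G♭𝔮⋆)⁻¹`): for every sub-family `f`,
`∃ M₄ a₄ C δ₁ > 0, ∀ j …, ∀ U ∈ (3.35)∩(3.36), ∀ n y y′, (hKernelOfOp (f j).toKIdx (bg9YR …) id (HAFlatY …) (parH (f j))).e n U y y′ ≤ C·(Lʲη)^{−n}(L^{j′}η)^{−(d+1)}e^{−(δ₁∕2)d}`.
ITS DISPLAYED ANALYTIC INPUTS ARE EXACTLY WHAT IS OWED for the K0ᴬ junction (this seat's LOCATED line 2026-08-31 I.13096): `he0♭ ∕ he1♭` — the (2.51) entries of `G♭` and `D∘G♭` read in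
the `𝔬12.G0` slot (Thm 3.3-type for the flat scheme; NOT the certificate's G₀ layer, which sits at the block-average site pair); `hcoA♭` — the coercivity of the normalised `𝔮G♭𝔮⋆`
(Thm 3.11-type for `Δ_a♭`); plus the knit `Q⋆` letter `hqsK` and the regime rows (the certificate's own).  No supplier of `he0♭ ∕ he1♭ ∕ hcoA♭` exists today (L–XL, unowned).

HONEST FRAMING.  A one-line instance (`exact`); nothing of [B9] asserted; every analytic input displayed; the readback identity is def-Y's (owed, RR-2 NOTE I.13105 (6)); count-neutral;
N06 NOT discharged; K0ᴬ∕K1ᴬ not closed; nothing continuum ∕ OS ∕ Clay; **the Yang–Mills mass gap is NOT proved.**  0 `def`, 0 `sorry`; NEW file.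
-/

noncomputable section

namespace Summit.QuantumFields.YangMills.BalabanUVNodes.N06Ineq3133HAFlatAtPinsKnitQJ

open Literature.MathematicalPhysics.QuantumFieldTheory.Balaban1983to89 open Literature.MathematicalPhysics.QuantumFieldTheory.Balaban1983to89.Node00 (FBondY IBondY SiteY CfgY SiteParY SiteOpY parSymY GpY GpPhysY BondOpY parBY BondParY) open Literature.MathematicalPhysics.QuantumFieldTheory.Balaban1983to89.Node00.OpsYSectDCoords (DvcoKH DvscoKH TpicoK T2coK cR39_trBasis_pos) open B9Thm39ReadingCoords (cR39 coordBound39 basisBound39) open B9Thm34Ext (toB6) open B11SectG (HasMaj BlockNorm) open B9Thm312Whole (cNorm GeoOK) open B9Thm312WholeClasses (cNormR rwt rwt_nonneg) open B9CoReadingCoords (XBK blkBK coordOpK cdBₗ) open B9CoReadingCoordsS (XSK sIK blkSK GcoS) open B9CoReadingCoordsH (XHK) open B9CoReadingCoordsTranspose (TrIdx trBasis) open B9PinMembersKLevelV1 (MemberY geo9Y) open B9BackgroundsKLevelV1R (RegFamY bg9YR MemOfFam) open B9GeoLemma21KLevelV1 (geo9Y_len_pos geo9Y_dist_triangle geo9Y_dist_comm)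 open B9GeoNormsKLevelV1 (geo9K geo9K_dist_nonneg) open B7Prop2SpecialUnitary (specialUnitaryUnits) open B9PerturbationMajorantAlgebra (Proj349Maj Thm31GpMaj hasMaj_weaken) open B9PerturbationMajorantsAtLetters (PcoK) open B9MultiscaleSmoothPartitionYNear (rNear) open B9MultiscaleSmoothPartitionYLip (CLip CLip_nonneg) open B9SmoothHolderClassP (bHZKP bHZKPG bHZPG) open B9GradViaDivLettersTransported (taxiB taxiS) open B9PerturbationSplitAtLetters (TaLcoK TbLcoKH Ta2LcoK Tb2LcoKH) open B9PerturbationL2Delta2 (D2coK) open B9SmoothHolderClassPProducers (CTel CTel_nonneg) open B9RowSum261DefiniteFaces (rowConst261 rowConst261_nonneg) open B9SectDSup (weightNorm) open B6RandomWalk (HasMajorant) open B6RandomWalkHom (HasMajorantHom) open B9Thm312WholeStepRegular (StepS LettersS3131) open B9CoReadingCoordsHolder (PK) open B9CoReadingCoordsHolderAdm (holderProbesKA) open B9RWSums343Holder (HolderProbes) open B9PerturbationMajorantAlgebra (CurrentMaj) open B9PerturbationMajorantsAtLetters (BcoKH BdcoKH) open B9Thm313WholeDir (Thm33G0DirR)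 open B9Thm313WholeDirInputBC (Letters313IML) open B9LettersHZAtOne (plateau_pos) open B9CoReadingCoordsInput (bHK) open B9CoReadingCoordsInputS (bHS) open B9CoRealizesRelAtLetters (RelB) open B9Thm33G0ProbeZeroAtCutPins (pX0_of_pins) open B6GlobalChartV1 (blkV1) open B6Ineq2142KLevelV1 (β lvl) open B6Geom246MultiLevelTorus (geomT) open Summit.QuantumFields.YangMills.BalabanUVNodes.N06HolderPinsGradedAtRecord (links_le_one) open Summit.QuantumFields.YangMills.BalabanUVNodes.N06TbHLegAtPinsPhysPU (htbH_of_pinsP43_geo9Y) open Summit.QuantumFields.YangMills.BalabanUVNodes.N06LettersSAtPinsPU (hLettersS_of_pinsP44_geo9Y) open Summit.QuantumFields.YangMills.BalabanUVNodes.N06StateClassFactsAtPinsPU (hStateFacts_of_pinsP_geo9Y) open Summit.QuantumFields.YangMills.BalabanUVNodes.N06StateProducerG0AtPinsPU (hG0S2_of_pinsP_geo9Y) open Summit.QuantumFields.YangMills.BalabanUVNodes.N06StateProducersAAtPinsPU (hProducersA_of_pinsP_geo9Y) open Summit.QuantumFields.YangMills.BalabanUVNodes.N06StateProducersBAtPinsPUW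 (hProducersBW_of_pinsP_geo9Y) open Summit.QuantumFields.YangMills.BalabanUVNodes.N06StatePairsAtPinsPU (hStatePairs_of_pinsP_geo9Y) open Summit.QuantumFields.YangMills.BalabanUVNodes.N06StateAssemblyAtPinsPUW (hStateAssemblyW_of_faces)
open scoped Matrix.Norms.L2Operator
open Summit.QuantumFields.YangMills.BalabanUVNodes.N06GDSupSubLegAtPinsPUWIPar (gdsup_sub_of_pins_inv_par) open Literature.MathematicalPhysics.QuantumFieldTheory.Balaban1983to89.Node00 (deltaAQY parBY_mem QGQOfQY GDQY QGQinvQY delta2OfQY) open Literature.MathematicalPhysics.QuantumFieldTheory.Balaban1983to89.Node00.OpsYOps312OfRecordPar (S0coKq QcoKHq CcoKq) open Literature.MathematicalPhysics.QuantumFieldTheory.Balaban1983to89.Node00.OpsYSectDCoordsQ (S0coKq_sub_TpicoK_mul_GcoK_GDQY) open Literature.MathematicalPhysics.QuantumFieldTheory.Balaban1983to89.B9B8AveragingJunction (parKnitY) open Literature.MathematicalPhysics.QuantumFieldTheory.Balaban1983to89.B9Thm311ReadingCoords (IsAdjTr IsSymmTr PosDefTr) open Literature.MathematicalPhysics.QuantumFieldTheory.Balaban1983to89.B9Eq316AveragingTransposeZd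 (alphaQ) open Literature.MathematicalPhysics.QuantumFieldTheory.Balaban1983to89.B9C2FormBoxRegimeY (Kpl) open Literature.MathematicalPhysics.QuantumFieldTheory.Balaban1983to89.B9Eq3115KnitLetterYOnto (kCol) open Literature.MathematicalPhysics.QuantumFieldTheory.Balaban1983to89.B9Eq3132TentBumps (Cth) open Literature.MathematicalPhysics.QuantumFieldTheory.Balaban1983to89.B7Prop2Explicit (C0 c2') open Literature.MathematicalPhysics.QuantumFieldTheory.Balaban1983to89.B9BackgroundsKLevelV1P (bg9KP) open Literature.MathematicalPhysics.QuantumFieldTheory.Balaban1983to89.B6KLevelCensusIndexV1 (kGeo) open Literature.MathematicalPhysics.QuantumFieldTheory.Balaban1983to89.B9Eq3132ClassLetterFromNu (hasMaj_cNorm_weightNorm_coordOpK_geo9Y_of_ineq3132Nu) open Literature.MathematicalPhysics.QuantumFieldTheory.Balaban1983to89.B9LettersZCFieldsAtPins (const3132_le) open Literature.MathematicalPhysics.QuantumFieldTheory.Balaban1983to89.B9Thm39ReadingCoords (abs_repr_le) open Literature.MathematicalPhysics.QuantumFieldTheory.Balaban1983to89.B7Prop2SpecialUnitary (specialUnitaryUnits_le_unitaryUnits)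 open Summit.QuantumFields.YangMills.BalabanUVNodes.N06Eq3132DecayFromMajorantKnitQ (decayUnder_QGQOfQY_knit_of_majorants_R) open Summit.QuantumFields.YangMills.BalabanUVNodes.N06Eq3132CoerciveFromGAKnitQ (coerciveUnder_of_subMajorants_knit_R) open Summit.QuantumFields.YangMills.BalabanUVNodes.N06Eq3132CoerciveVariationalQ (hcoA_of_testFamily_QR) open Summit.QuantumFields.YangMills.BalabanUVNodes.N06Eq3132KnitTestFamilyQ (hTt_knit_of_pins) open Summit.QuantumFields.YangMills.BalabanUVNodes.N06SectDUnitsAtPinsPhysQ (isUnit_deltaPiAQY_of_formSmall) open Summit.QuantumFields.YangMills.BalabanUVNodes.N06D2SupLegAtPinsPUWQ (d2sup_of_pins_q) open Literature.MathematicalPhysics.QuantumFieldTheory.Balaban1983to89.B9Eq3132NuReadingR (stmt3132Printed_nu_of_coercive_decay_R) open Literature.MathematicalPhysics.QuantumFieldTheory.Balaban1983to89.B9Eq3132StepDifference (GcoK_sub) open Literature.MathematicalPhysics.QuantumFieldTheory.Balaban1983to89.B9LettersZCFieldsAtPinsB (c2_pinsB) open Literature.MathematicalPhysics.QuantumFieldTheory.Balaban1983to89.B9Thm311ReadingCoords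 (PosDefTr) open Literature.MathematicalPhysics.QuantumFieldTheory.Balaban1983to89.B9BackgroundsKLevelV1R (regY335 regY336) open Literature.MathematicalPhysics.QuantumFieldTheory.Balaban1983to89.B9RWSumsReadsNbr (nbr) open Literature.MathematicalPhysics.QuantumFieldTheory.Balaban1983to89.B9Ineq349SiteFromConv342 (contractive_of_mem) open Literature.MathematicalPhysics.QuantumFieldTheory.Balaban1983to89.B7Prop2SpecialUnitary (specialUnitaryUnits_le_unitaryUnits) open B9Thm39ReadingCoords (cR39_nonneg)
open Summit.QuantumFields.YangMills.BalabanUVNodes.N06D2SupLegAtPinsPUW (d2sup_of_pins) open Summit.QuantumFields.YangMills.BalabanUVNodes.N06SectDUnitsAtPinsPhys (isUnit_deltaPiAY_of_formSmall_phys) open Literature.MathematicalPhysics.QuantumFieldTheory.Balaban1983to89.Node00 (Stage3Params C2Y delta2OfY trDualMatY delta2PiY) open Literature.MathematicalPhysics.QuantumFieldTheory.Balaban1983to89.Node00.OpsYSectDCoords (S0coK CcoK S0coK_sub_TpicoK_mul_GcoK_GDY) open Literature.MathematicalPhysics.QuantumFieldTheory.Balaban1983to89.B9BackgroundsKLevelV1P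 (bg9YP) open Literature.MathematicalPhysics.QuantumFieldTheory.Balaban1983to89.B9PinGeometryKLevelV1 (c35Y) open Literature.MathematicalPhysics.QuantumFieldTheory.Balaban1983to89.B9Eq3132SectDLetters (GDY) open Literature.MathematicalPhysics.QuantumFieldTheory.Balaban1983to89.B9Thm312Whole (FormSmall PosDefEnd) open Literature.MathematicalPhysics.QuantumFieldTheory.Balaban1983to89.B9SectDL2Decay (bl2) open Literature.MathematicalPhysics.QuantumFieldTheory.Balaban1983to89.B9Thm312WholeFormSmallFromL2 (abs_form_le_of_stepBlockBd weightedL2_le_form_of_l0) open Literature.MathematicalPhysics.QuantumFieldTheory.Balaban1983to89.B11SectG (RowSum) open Literature.MathematicalPhysics.QuantumFieldTheory.Balaban1983to89.B9GeoLemma21KLevelV1 (rowSum261_geo9Y) open B9CoReadingCoords (GcoK) open B9CoReadingCoordsH (blkHK) open B9Delta2FormMajorant (C2FormMaj)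
open Summit.QuantumFields.YangMills.BalabanUVNodes.N06Eq3132KnitTestFamilyQ (hTt_knit_of_pins)
open Literature.MathematicalPhysics.QuantumFieldTheory.Balaban1983to89.B9Eq3132NuReading (siteKernelOfOpNu nuY lamInvY)
open Literature.MathematicalPhysics.QuantumFieldTheory.Balaban1983to89.B9Eq3132RingInverseReading (normMatY)
open Literature.MathematicalPhysics.QuantumFieldTheory.Balaban1983to89.B9Eq3132CTInputs (CoerciveUnder)
open Literature.MathematicalPhysics.QuantumFieldTheory.Balaban1983to89.B9Eq3132ScalarIndex (geoComap)
open Literature.MathematicalPhysics.QuantumFieldTheory.Balaban1983to89.Node00 (hKernelOfOp)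
open Literature.MathematicalPhysics.QuantumFieldTheory.Balaban1983to89.Node00.OpsYOps312OfRecordPar (QscoKHq)
open Literature.MathematicalPhysics.QuantumFieldTheory.Balaban1983to89.Node00.OpsYSectDCoords (coordOpKH_const_comp_coordOpK_const coordOpK_const_comp_coordOpKH_const cR39_trBasis_pos)
open Literature.MathematicalPhysics.QuantumFieldTheory.Balaban1983to89.B9CoReadingCoords (GcoK DcoK coordOpK)
open Literature.MathematicalPhysics.QuantumFieldTheory.Balaban1983to89.B9CoReadingCoordsH (HcoK coordOpKH blkHK coRealizesHRel_hKernel_coords_zero coRealizesHRel_hKernel_coords_one)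
open Literature.MathematicalPhysics.QuantumFieldTheory.Balaban1983to89.B9CoRealizesRelAtLetters (RelB relB_refl len_eq_of_relB dist_eq_of_relB)
open Literature.MathematicalPhysics.QuantumFieldTheory.Balaban1983to89.B9Eq3132ClassLetterFromNu (hasMaj_cNorm_weightNorm_coordOpK_geo9Y_of_ineq3132Nu)
open Literature.MathematicalPhysics.QuantumFieldTheory.Balaban1983to89.B9Thm313WholeQstarFromG0 (gQs2_of_e0 dgQs_of_e1)
open Literature.MathematicalPhysics.QuantumFieldTheory.Balaban1983to89.B9RWSums347DefiniteFacesWindow (scaleTransfer_rpow_geo9Y)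
open Literature.MathematicalPhysics.QuantumFieldTheory.Balaban1983to89.B9LettersHZAtOne (plateau_pos)
open Literature.MathematicalPhysics.QuantumFieldTheory.Balaban1983to89.B9Thm39ReadingCoords (cR39 abs_repr_le)
open Literature.MathematicalPhysics.QuantumFieldTheory.Balaban1983to89.B9Thm312Whole (GeoOK cNorm)
open Literature.MathematicalPhysics.QuantumFieldTheory.Balaban1983to89.B9SectDSup (weightNorm)
open Literature.MathematicalPhysics.QuantumFieldTheory.Balaban1983to89.B11SectG (HasMaj BlockNorm RowSum)
open Literature.MathematicalPhysics.QuantumFieldTheory.Balaban1983to89.B9GeoLemma21KLevelV1 (geo9Y_dist_triangle geo9Y_dist_comm geo9Y_len_pos rowSum261_geo9Y)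
open Literature.MathematicalPhysics.QuantumFieldTheory.Balaban1983to89.B9GeoNormsKLevelV1 (geo9K_dist_nonneg)
open Literature.MathematicalPhysics.QuantumFieldTheory.Balaban1983to89.B9GeoLemma21KLevelV1 (geo9K_one_le_L)
open Literature.MathematicalPhysics.QuantumFieldTheory.Balaban1983to89.B9Eq3133SlotAHZ (ineq3133flat_sup_of_lettersZ_rel)
open Literature.MathematicalPhysics.QuantumFieldTheory.Balaban1983to89.Node00.OpsYDeltaAFlat (GAFlatY HAFlatY)
open Summit.QuantumFields.YangMills.BalabanUVNodes.N06Ineq3133SlotAAtPinsKnitQJ (ineq3133flat_of_pins_knit_J)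

variable {N : ℕ} {θ : Stage3Params} {Mstar : ℕ}

/-- ★★★ **(3.133) AT SLOT (a) FOR `H♭[𝔮] = HAFlatY` (def-Y's flat-pair letter) AT THE KNIT RECORD, ALONG `f`** — the `T₀ := G♭[𝔮]` instance of ✓`ineq3133flat_of_pins_knit_J`;
the partner statement of the owed readback `H1OfRecordAtBgFlat ↔ HAFlatY`; inputs `he0♭ he1♭ hcoA♭` displayed (unowned). [cite: Balaban1985BackgroundPropagators, (3.133) p.422, (3.126) p.420, (3.26)–(3.27) p.395, (3.130) p.421; Balaban1985Variational, (103) p.293, (110) p.294] -/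
theorem ineq3133_HAFlatY_of_pins_knit_J [NeZero N] [∀ x : MemberY θ.d₆ θ.ℓ₆ θ.hd' θ.hL' θ.b₀ θ.b₁ Mstar, Fintype (geo9Y x).Site]
    [∀ x : MemberY θ.d₆ θ.ℓ₆ θ.hd' θ.hL' θ.b₀ θ.b₁ Mstar, DecidableEq (geo9Y x).Site]
    {R₁ R₂ : RegFamY θ.d₆ θ.ℓ₆ θ.hd' θ.hL' θ.b₀ θ.b₁ Mstar (Matrix (Fin N) (Fin N) ℂ)} (H : MemberY θ.d₆ θ.ℓ₆ θ.hd' θ.hL' θ.b₀ θ.b₁ Mstar → Prop) {J : Type} (f : J → MemberY θ.d₆ θ.ℓ₆ θ.hd' θ.hL' θ.b₀ θ.b₁ Mstar)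
    (bI : ∀ x : MemberY θ.d₆ θ.ℓ₆ θ.hd' θ.hL' θ.b₀ θ.b₁ Mstar, FBondY x.toKIdx → IBondY x.toKIdx)
    (hlev : ∀ (x : MemberY θ.d₆ θ.ℓ₆ θ.hd' θ.hL' θ.b₀ θ.b₁ Mstar) (f : FBondY x.toKIdx), lvl x.hN x.D x.hk (bI x f) = (blkV1 x.hN x.D f).1.1)
    (hβ1 : ∀ (x : MemberY θ.d₆ θ.ℓ₆ θ.hd' θ.hL' θ.b₀ θ.b₁ Mstar) (f : FBondY x.toKIdx), (geomT x.D).dist (β x.hN x.D x.hk (bI x f)) (blkV1 x.hN x.D f) ≤ 1)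
    (hβI : ∀ (x : MemberY θ.d₆ θ.ℓ₆ θ.hd' θ.hL' θ.b₀ θ.b₁ Mstar) (fb : FBondY x.toKIdx) (cc : IBondY x.toKIdx), blkV1 x.hN x.D fb = β x.hN x.D x.hk cc → β x.hN x.D x.hk (bI x fb) = blkV1 x.hN x.D fb)
    {mN : ℕ} (hnbr : ∀ (x : MemberY θ.d₆ θ.ℓ₆ θ.hd' θ.hL' θ.b₀ θ.b₁ Mstar) (y : (geo9Y x).Site), (nbr (geo9Y x) ((θ.ℓ₆ : ℝ) + 4) y).card ≤ mN)
    (c : ℝ)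
    -- print's knit averaging pair and the slot-(a) form `Δ_a[𝔮]`, `T₀ = Δ_a[𝔮]⁻¹ = G₀`; a bond transporter for the (unread) Hölder slot of the reading
    (𝔮 : ∀ x : MemberY θ.d₆ θ.ℓ₆ θ.hd' θ.hL' θ.b₀ θ.b₁ Mstar, Node00.OpsYQLetter.QLetterY (Matrix (Fin N) (Fin N) ℂ) x.toKIdx)
    (𝔮s : ∀ x : MemberY θ.d₆ θ.ℓ₆ θ.hd' θ.hL' θ.b₀ θ.b₁ Mstar, Node00.OpsYQLetter.QsLetterY (Matrix (Fin N) (Fin N) ℂ) x.toKIdx)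
    (h𝔮 : ∀ (x : MemberY θ.d₆ θ.ℓ₆ θ.hd' θ.hL' θ.b₀ θ.b₁ Mstar) (U : CfgY (Matrix (Fin N) (Fin N) ℂ) x.toKIdx), 𝔮 x U = B9Eq3115KnitLetterY.QknitY x.toKIdx U)
    (h𝔮s : ∀ (x : MemberY θ.d₆ θ.ℓ₆ θ.hd' θ.hL' θ.b₀ θ.b₁ Mstar) (U : CfgY (Matrix (Fin N) (Fin N) ℂ) x.toKIdx), 𝔮s x U = Node00.OpsYQLetter.adjTrY (B9Eq3115KnitLetterY.QknitY x.toKIdx U))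
    (a' : ℝ)
    (parH : ∀ x : MemberY θ.d₆ θ.ℓ₆ θ.hd' θ.hL' θ.b₀ θ.b₁ Mstar, BondParY (Matrix (Fin N) (Fin N) ℂ) x.toKIdx)
    -- the knit regime rows (numerics + the (3.35) class bridge)
    {c₀ : ℝ} (hc : c₀ ≤ 10)
    (hRP : ∀ (x : MemberY θ.d₆ θ.ℓ₆ θ.hd' θ.hL' θ.b₀ θ.b₁ Mstar) (α₀ : ℝ) (U : (bg9YR (Matrix (Fin N) (Fin N) ℂ) (specialUnitaryUnits (Fin N)) R₁ R₂ x).Cfg),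
      (bg9YR (Matrix (Fin N) (Fin N) ℂ) (specialUnitaryUnits (Fin N)) R₁ R₂ x).Reg335 c α₀ U → (bg9KP (Matrix (Fin N) (Fin N) ℂ) (specialUnitaryUnits (Fin N)) x.toKIdx).Reg335 c₀ α₀ U)
    {α₀' : ℝ} (hα' : 0 < α₀') (hαQ : α₀' ≤ alphaQ (θ.d₆ + 1) (θ.ℓ₆ + 1))
    {aK : ℝ} (haK : 0 < aK)
    (hKpl : ∀ (x : MemberY θ.d₆ θ.ℓ₆ θ.hd' θ.hL' θ.b₀ θ.b₁ Mstar) (a : ℝ), 0 ≤ a → a ≤ aK → Kpl x.toKIdx a * (kGeo x.toKIdx).L ^ 4 < α₀')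
    -- the G₀-layer walk model `𝔬12` (block maps, `G0`, `D`, `Qstar` slots) and its pins at the knit record
    (𝔬12 : ∀ x : MemberY θ.d₆ θ.ℓ₆ θ.hd' θ.hL' θ.b₀ θ.b₁ Mstar, B9Thm312Whole.Ops (geo9Y x) (bg9YR (Matrix (Fin N) (Fin N) ℂ) (specialUnitaryUnits (Fin N)) R₁ R₂ x) (XBK (TrIdx N) x.toKIdx) (XBK (TrIdx N) x.toKIdx) (XHK (TrIdx N) x.toKIdx) (XSK (TrIdx N) x.toKIdx))
    (hblk12 : ∀ x : MemberY θ.d₆ θ.ℓ₆ θ.hd' θ.hL' θ.b₀ θ.b₁ Mstar, (𝔬12 x).blk = blkBK x.toKIdx (bI x)) (hblkY12 : ∀ x : MemberY θ.d₆ θ.ℓ₆ θ.hd' θ.hL' θ.b₀ θ.b₁ Mstar, (𝔬12 x).blkY = blkBK x.toKIdx (bI x))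
    (hblkZ12 : ∀ x : MemberY θ.d₆ θ.ℓ₆ θ.hd' θ.hL' θ.b₀ θ.b₁ Mstar, (𝔬12 x).blkZ = blkHK x.toKIdx)
    (hG0co12 : ∀ (x : MemberY θ.d₆ θ.ℓ₆ θ.hd' θ.hL' θ.b₀ θ.b₁ Mstar) (U : (bg9YR (Matrix (Fin N) (Fin N) ℂ) (specialUnitaryUnits (Fin N)) R₁ R₂ x).Cfg), (𝔬12 x).G0 U = GcoK x.toKIdx (trBasis N) (bg9YR (Matrix (Fin N) (Fin N) ℂ) (specialUnitaryUnits (Fin N)) R₁ R₂ x) (fun U => U) (fun U => GAFlatY x.toKIdx a' (𝔮 x) (𝔮s x) U) U)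
    (hDco12 : ∀ (x : MemberY θ.d₆ θ.ℓ₆ θ.hd' θ.hL' θ.b₀ θ.b₁ Mstar) (U : (bg9YR (Matrix (Fin N) (Fin N) ℂ) (specialUnitaryUnits (Fin N)) R₁ R₂ x).Cfg), (𝔬12 x).D U = DcoK x.toKIdx (trBasis N) (bg9YR (Matrix (Fin N) (Fin N) ℂ) (specialUnitaryUnits (Fin N)) R₁ R₂ x) (fun U => U) U)
    (hQsco12q : ∀ (x : MemberY θ.d₆ θ.ℓ₆ θ.hd' θ.hL' θ.b₀ θ.b₁ Mstar) (U : (bg9YR (Matrix (Fin N) (Fin N) ℂ) (specialUnitaryUnits (Fin N)) R₁ R₂ x).Cfg), (𝔬12 x).Qstar U = QscoKHq x.toKIdx (trBasis N) (bg9YR (Matrix (Fin N) (Fin N) ℂ) (specialUnitaryUnits (Fin N)) R₁ R₂ x) (fun U => U) (𝔮s x) U)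
    -- the G₀ layer's (2.51) entries of `G₀` and `∇_U∘G₀` (Thm 3.3 (3.42)₀, (3.42)₁-hom for `G₀`), member-wide above `(M₀, a₀)`
    {M₀ a₀ B12₀ δ12₀ : ℝ} (ha₀ : 0 < a₀) (hB12₀ : 0 ≤ B12₀) (hδ12₀ : 0 < δ12₀)
    (he0 : ∀ x : MemberY θ.d₆ θ.ℓ₆ θ.hd' θ.hL' θ.b₀ θ.b₁ Mstar, M₀ ≤ (geo9Y x).M → ∀ α₀ : ℝ, 0 < α₀ → (geo9Y x).M * α₀ ≤ a₀ → ∀ U : (bg9YR (Matrix (Fin N) (Fin N) ℂ) (specialUnitaryUnits (Fin N)) R₁ R₂ x).Cfg, (bg9YR (Matrix (Fin N) (Fin N) ℂ) (specialUnitaryUnits (Fin N)) R₁ R₂ x).Reg335 c α₀ U → (bg9YR (Matrix (Fin N) (Fin N) ℂ) (specialUnitaryUnits (Fin N)) R₁ R₂ x).Reg336 c α₀ U →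
      HasMajorant (g := toB6 (geo9Y x) 1 (H x)) (𝔬12 x).blk ((𝔬12 x).G0 U) (fun (a b : (geo9Y x).Site) => B12₀ * (geo9Y x).len a ^ 2 * Real.exp (-(δ12₀ * (geo9Y x).dist a b))))
    (he1 : ∀ x : MemberY θ.d₆ θ.ℓ₆ θ.hd' θ.hL' θ.b₀ θ.b₁ Mstar, M₀ ≤ (geo9Y x).M → ∀ α₀ : ℝ, 0 < α₀ → (geo9Y x).M * α₀ ≤ a₀ → ∀ U : (bg9YR (Matrix (Fin N) (Fin N) ℂ) (specialUnitaryUnits (Fin N)) R₁ R₂ x).Cfg, (bg9YR (Matrix (Fin N) (Fin N) ℂ) (specialUnitaryUnits (Fin N)) R₁ R₂ x).Reg335 c α₀ U → (bg9YR (Matrix (Fin N) (Fin N) ℂ) (specialUnitaryUnits (Fin N)) R₁ R₂ x).Reg336 c α₀ U →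
      HasMajorantHom (g := toB6 (geo9Y x) 1 (H x)) (𝔬12 x).blk (𝔬12 x).blkY ((𝔬12 x).D U ∘ₗ (𝔬12 x).G0 U)
        (fun (a b : (geo9Y x).Site) => B12₀ * (geo9Y x).len a * Real.exp (-(δ12₀ * (geo9Y x).dist a b))))
    -- the knit `Q⋆` letter of the heads (member-wide above `(M12, a12)`, (3.35) only)
    {M12 a12 BQ δQ : ℝ} (ha12 : 0 < a12) (hBQ : 0 ≤ BQ) (hδQ : 0 < δQ)
    (hqsK : ∀ x : MemberY θ.d₆ θ.ℓ₆ θ.hd' θ.hL' θ.b₀ θ.b₁ Mstar, M12 ≤ (geo9Y x).M → ∀ α₀ : ℝ, 0 < α₀ → (geo9Y x).M * α₀ ≤ a12 → ∀ U : (bg9YR (Matrix (Fin N) (Fin N) ℂ) (specialUnitaryUnits (Fin N)) R₁ R₂ x).Cfg, (bg9YR (Matrix (Fin N) (Fin N) ℂ) (specialUnitaryUnits (Fin N)) R₁ R₂ x).Reg335 c α₀ U →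
      HasMaj (weightNorm (BlockNorm.ofBlocks (toB6 (geo9Y x) 1 (H x)) (𝔬12 x).blkZ) (fun y => ((((θ.ℓ₆ + 1 : ℕ) : ℝ) ^ (θ.d₆ + 1)) ^ lvl x.hN x.D x.hk y)⁻¹) (fun y => (plateau_pos x.toKIdx y).le))
        (cNorm 1 (H x) (𝔬12 x).blk (fun y => (geo9Y_len_pos x y).le) 0) ((𝔬12 x).Qstar U) (fun a a' => BQ * Real.exp (-(δQ * (geo9Y x).dist a a'))))
    -- the coercivity of the normalised `𝔮 T₀ 𝔮⋆` along `f` (site-pair-generic: at the certificate's block-average pair = ✓`hcoA_of_testFamily_QR_J` on ROW 17 + ✓`hTt_knit_of_pins`;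
    -- at the centres pair of node00-def-Y's (ρ♭) it is the Thm-3.11-type row for `Δ_a♭` — displayed here)
    (hcoA : CoerciveUnder c (fun j : J => geoComap (geo9Y (f j)) (Prod.fst : (geo9Y (f j)).Site × TrIdx N → (geo9Y (f j)).Site))
      (fun j : J => (bg9YR (Matrix (Fin N) (Fin N) ℂ) (specialUnitaryUnits (Fin N)) R₁ R₂ (f j))) (fun j U => normMatY (trBasis N) (lamInvY (f j).toKIdx) (QGQOfQY (f j).toKIdx (𝔮 (f j)) (𝔮s (f j)) (fun U => GAFlatY (f j).toKIdx a' (𝔮 (f j)) (𝔮s (f j)) U) U))) :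
    ∃ M₄ a₄ C δ₁ : ℝ, 0 < M₄ ∧ 0 < a₄ ∧ 0 < C ∧ 0 < δ₁ ∧
      ∀ j : J, M₄ ≤ (geo9Y (f j)).M → ∀ α₀ : ℝ, 0 < α₀ → (geo9Y (f j)).M * α₀ ≤ a₄ →
        ∀ U : (bg9YR (Matrix (Fin N) (Fin N) ℂ) (specialUnitaryUnits (Fin N)) R₁ R₂ (f j)).Cfg, (bg9YR (Matrix (Fin N) (Fin N) ℂ) (specialUnitaryUnits (Fin N)) R₁ R₂ (f j)).Reg335 c α₀ U → (bg9YR (Matrix (Fin N) (Fin N) ℂ) (specialUnitaryUnits (Fin N)) R₁ R₂ (f j)).Reg336 c α₀ U →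
          ∀ (n : Fin 2) (y y' : (geo9Y (f j)).Site),
            (hKernelOfOp (f j).toKIdx (bg9YR (Matrix (Fin N) (Fin N) ℂ) (specialUnitaryUnits (Fin N)) R₁ R₂ (f j)) (fun U => U) (HAFlatY (f j).toKIdx a' (𝔮 (f j)) (𝔮s (f j))) (parH (f j))).e n U y y' ≤
              C * ((geo9Y (f j)).len y) ^ (-(n : ℝ)) * ((geo9Y (f j)).len y') ^ (-(((θ.d₆ + 1 : ℕ) : ℝ))) * Real.exp (-(δ₁ / 2 * (geo9Y (f j)).dist y y')) :=
  ineq3133flat_of_pins_knit_J H f bI hlev hβ1 hβI hnbr c 𝔮 𝔮s h𝔮 h𝔮s (fun x => fun U => GAFlatY x.toKIdx a' (𝔮 x) (𝔮s x) U) parH hc hRP hα' hαQ haK hKpl 𝔬12 hblk12 hblkY12 hblkZ12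
    hG0co12 hDco12 hQsco12q ha₀ hB12₀ hδ12₀ he0 he1 ha12 hBQ hδQ hqsK hcoA

end Summit.QuantumFields.YangMills.BalabanUVNodes.N06Ineq3133HAFlatAtPinsKnitQJ

end
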